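import Summits.BirchSwinnertonDyer.BirchSwinnertonDyer.Theorems.EisensteinPrimesBSDpOnCellCTelescopeBranchCofreeRealisation
import Summits.BirchSwinnertonDyer.BirchSwinnertonDyer.Theorems.EisensteinPrimesBSDpOnCellCTelescopeBranchCofreeRealisationFibres
import Literature.NumberTheory.EllipticCurves.OrdinaryNewformDatumSelfDualTwist
import Summits.BirchSwinnertonDyer.BirchSwinnertonDyer.Theorems.EisensteinPrimesBSDpOnCellCTelescopeK2ModuleDivOfLeavesCT
import HarnessLib

/-!
# [telescope — width x2-p2 g23, 2026-08-30] LEAF N1 `stub_branchLattice` REDUCED BY NAME TO ITS LATTICE-LEVEL CORE «N1♭»: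
# the registered CONCLUSION of N1 (v12/v13c text: `∃ (_ : TopologicalSpace ℤ_p⟦X⟧) A₂ … ρ₂ … , (cof) ∧ (tor) ∧ (cof₀) ∧ (cof_k) ∧ (unr) ∧
# (fd₀) ∧ ∀ k, (rat_k) ∧ (fd_k)`) FOLLOWS, for ANY road prefix, from FRAMED LATTICE DATA — a continuous `ρ : Γ_K →ₜ* GL₂(ℤ_p⟦X⟧)`
# unramified off `S₀`, an isogeny `(ℚ_p/ℤ_p)² → E[p^∞]|Γ_K` intertwining `ρ mod X`, and for every `k` an isogeny `(ℚ_p/ℤ_p)² → A_{g_k}†|Γ_K`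
# intertwining `ρ mod (X − x_k)` (+ (rat_k)) — via the cofree realisation `A₂ := (Λ^*)²` of #1/#2
# Crux 4 `BSDpOnCellC` (stmt-BirchSwinnertonDyer-19034), line «telescope» (`--supports`, helper; closes nothing)

WHY (N1-TYPING-x2p2g23.md §4 (R-c), evidence #59 on -19034): N1 is a CONSTRUCTION leaf; whatever supplies Hida's/Wiles' free rank-2
`ℤ_p⟦X⟧`-lattice with its specialisations (Hida 1986 Thm. 2.1 (2.2b)(2.2c) / Wiles 1988 §2 / a pseudo-character interpolation along the
ℚ_p-rational chart) supplies it FRAMED. §2 `branchLattice_conclusion_of_framed` is the prefix-agnostic bridge «framed lattice data N1♭ ⟹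
N1's conclusion (v13c l.440–473, token for token)»; §3 `branchLattice_of_framed` is the same ON THE REGISTERED TEXT: «(prefix → N1♭) →
stub_branchLattice (v13c l.400–473, token for token)». Witness: `A₂ := Fin 2 → BigRepModule ℤ_[p] p (QpModZp p)` (`= T₂ ⊗_Λ Λ^∨`, #1
`exists_cofreeRealisation`), the DISCRETE topology on `B = ℤ_p⟦X⟧⟦T⟧` (`IsTopologicalRing B`, `ContinuousSMul B 𝐃` free), the `Λ`-module
structure on `X₂ = XBig κ ρ₂ 𝔭̄ ∅` through `algebraMap Λ B`; (cof)/(tor)/(cof₀)/(cof_k)/(unr) = #1; (fd₀)/(fd_k) = `exists_fibreMap`: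
`θ := e ∘ (Ψ ↦ (Ψ j 0)_j)` on the fibre — semilinear by `C_smul`, equivariant by #2 `matrixAction_apply_apply_of_torsionBy`, finite kernel
(evaluation at `0` injective on the fibre, #2) and finite cokernel (onto `(ℚ_p/ℤ_p)²`, #2 `exists_of_torsionBy`, `p ∣ x_k ⇔ ‖x_k‖ < 1`).
WHAT N1♭ SAYS IN PRINT TERMS: a free rank-2 `ℤ_p⟦X⟧`-lattice `T₂` with a continuous `Γ_K`-action, unramified outside a finite `S₀`
(`w ∈ S₀, w ∤ p ⇒ w ∣ N`), whose reduction `T₂/X ⊗ ℚ_p/ℤ_p` is isogenous (`ℤ_p`-linearly, `Γ_K`-equivariantly, finite kernel and cokernel)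
to `E[p^∞]`, and whose reduction at the `ℤ_p`-point `φ_k` (`φ_k X = x_k`) is isogenous, `ℤ_p → 𝒪_k`-semilinearly, to the member's self-dual
cofree module `A_{g_k}†` — Hida's (2.2b)/(2.2c) on Wiles' lattice, self-dual twisted. NOT proved here (the honest residual of N1, memo §4
(R-c)(i)–(iv)); no road-prefix clause other than `‖x k‖ < 1` is used.

HONEST FRAMING: a by-name reduction; constructs no Hida family; does not prove or register N1♭; closes no registered stub, no crux, no
summit statement; BSD is proved for no curve by this file. THEOREMS ONLY: no definition, no named fact, no instance, no `sorry`.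
References (shape only): [cite: Hida1986, Thm. 2.1 (2.2b) (2.2c)] [cite: Wiles1988, §2] [cite: Greenberg2006, p. 342 L4–11]
-/

set_option autoImplicit false
set_option linter.dupNamespace false

noncomputable section

open scoped Classical MatrixGroups ModularForm
open CongruenceSubgroup WeierstrassCurve NumberField IsDedekindDomain Field PowerSeries Finset
  Literature.NumberTheory.EllipticCurves Literature.NumberTheory.EllipticCurves.GreenbergSelmer
  Literature.NumberTheory.EllipticCurves.ModularForms Literature.NumberTheory.QuadraticFields
  Literature.NumberTheory.EllipticCurves.Rank1Residual
  Literature.NumberTheory.EllipticCurves.Rank1Residual.Typed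
  Literature.NumberTheory.GaloisRepresentations Literature.NumberTheory.GaloisCohomology
  Literature.NumberTheory.IwasawaTheory Literature.NumberTheory.IwasawaTheory.Greenberg2016
  Summit.BirchSwinnertonDyer.Rank1Residual.X11b.AcSelmer
  Summit.BirchSwinnertonDyer.Rank1Residual.X11b.Halves
  Summit.BirchSwinnertonDyer.Rank1Residual.X11b
  Summit.BirchSwinnertonDyer.Rank1Residual Summit.BirchSwinnertonDyer.Rank1Residual.X1
  Summit.BirchSwinnertonDyer.Rank1Residual.X2
open Literature.NumberTheory.EllipticCurves.BigGaloisRep Literature.NumberTheory.EllipticCurves.Castella2018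
open Summit.BirchSwinnertonDyer.BirchSwinnertonDyer.Theorems
  Summit.BirchSwinnertonDyer.BirchSwinnertonDyer.Theorems.TelescopeBranchCofreeRealisation
  Summit.BirchSwinnertonDyer.BirchSwinnertonDyer.Theorems.TelescopeBranchCofreeRealisationFibres

namespace Summit.BirchSwinnertonDyer.BirchSwinnertonDyer.Theorems.TelescopeBranchLatticeOfFramed

/-! ## §1 Two small facts and the fibre map -/

/-- `‖c‖ < 1` in `ℤ_p` means `p ∣ c` (the points of the open unit disc are the multiples of `p`). [folklore] -/
theorem dvd_of_norm_lt_one {p : ℕ} [Fact p.Prime] {c : ℤ_[p]} (hc : ‖c‖ < 1) : (p : ℤ_[p]) ∣ c :=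
  (PadicInt.norm_lt_one_iff_dvd c).mp hc
/-- At the point `constantCoeff` (`c = 0`), `X − C (φ X)` is `X`. [folklore] -/
theorem X_sub_C_constantCoeff_X {R : Type*} [CommRing R] :
    (PowerSeries.X - PowerSeries.C (PowerSeries.constantCoeff (R := R) PowerSeries.X) : PowerSeries R) = PowerSeries.X := by
  rw [PowerSeries.constantCoeff_X, map_zero, sub_zero]
/-- **The fibre map of the cofree realisation at a `ℤ_p`-point `φ` (`p ∣ φ X`, `r = X − C (φ X)`), composed with an isogeny `e` into any
target** (prescribed «scalars» `sm`/«action» `act`: `e (c • v) = sm c (e v)`, `e ((ρ σ mod r) v) = act σ (e v)`; finite kernel and cokernel):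
`θ := e ∘ (a ↦ (a j 0)_j)` on `A₂[r]` is `C`-semilinear, `torsionRep ρ₂ r`-equivariant, with finite kernel (evaluation at `0` is injective on
the fibre) and finite cokernel (`θ.range = e.range`). Common core of (fd₀) (`φ = constantCoeff`) and (fd_k) (`φ X = x_k`).
[cite: Hida1986, Thm. 2.1 (2.2c)] [cite: Greenberg2006, p. 342 L4–11] -/
theorem exists_fibreMap {p : ℕ} [Fact p.Prime] {n : ℕ} {G : Type} [Group G] [TopologicalSpace G]
    [TopologicalSpace (PowerSeries ℤ_[p])]
    (ρ : G →ₜ* GL (Fin n) (PowerSeries ℤ_[p]))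
    (ρ₂ : ContinuousRep G (PowerSeries ℤ_[p]) (Fin n → BigRepModule ℤ_[p] p (QpModZp p)))
    (hρ₂ : ∀ (g : G) (Ψ : Fin n → BigRepModule ℤ_[p] p (QpModZp p)) (i : Fin n),
      ρ₂ g Ψ i = ∑ j, ((ρ g : GL (Fin n) (PowerSeries ℤ_[p])) : Matrix (Fin n) (Fin n) (PowerSeries ℤ_[p])) i j • Ψ j)
    (φ : PowerSeries ℤ_[p] →+* ℤ_[p]) (hφ : ∀ r : ℤ_[p], φ (PowerSeries.C r) = r) (hc : (p : ℤ_[p]) ∣ φ PowerSeries.X)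
    {r : PowerSeries ℤ_[p]} (hr : r = PowerSeries.X - PowerSeries.C (φ PowerSeries.X))
    {M : Type*} [AddCommGroup M] (sm : ℤ_[p] → M → M) (act : G → M → M) (e : (Fin n → QpModZp p) →+ M)
    (he_lin : ∀ (c : ℤ_[p]) (v : Fin n → QpModZp p), e (c • v) = sm c (e v))
    (he_eq : ∀ (σ : G) (v : Fin n → QpModZp p),
      e (fun i ↦ ∑ j, φ (((ρ σ : GL (Fin n) (PowerSeries ℤ_[p])) : Matrix (Fin n) (Fin n) (PowerSeries ℤ_[p])) i j) • v j) =
        act σ (e v))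
    (hker : Finite e.ker) (hcoker : Finite (M ⧸ e.range)) :
    ∃ θ : Submodule.torsionBy (PowerSeries ℤ_[p]) (Fin n → BigRepModule ℤ_[p] p (QpModZp p)) r →+ M,
      (∀ (c : ℤ_[p]) (a : Submodule.torsionBy (PowerSeries ℤ_[p]) (Fin n → BigRepModule ℤ_[p] p (QpModZp p)) r),
          θ (PowerSeries.C c • a) = sm c (θ a)) ∧
      (∀ (σ : G) (a : Submodule.torsionBy (PowerSeries ℤ_[p]) (Fin n → BigRepModule ℤ_[p] p (QpModZp p)) r),
          θ (BigGaloisRep.torsionRep ρ₂ r σ a) = act σ (θ a)) ∧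
      Finite θ.ker ∧ Finite (M ⧸ θ.range) := by
  subst hr
  -- the fibre condition in `•`-form
  have hfib : ∀ a : Submodule.torsionBy (PowerSeries ℤ_[p]) (Fin n → BigRepModule ℤ_[p] p (QpModZp p))
      (PowerSeries.X - PowerSeries.C (φ PowerSeries.X)),
      (PowerSeries.X - PowerSeries.C (φ PowerSeries.X) : PowerSeries ℤ_[p]) •
        (a : Fin n → BigRepModule ℤ_[p] p (QpModZp p)) = 0 := fun a ↦
    (Submodule.mem_torsionBy_iff _ _).mp a.2
  -- evaluation at `0`
  let ev : Submodule.torsionBy (PowerSeries ℤ_[p]) (Fin n → BigRepModule ℤ_[p] p (QpModZp p))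
      (PowerSeries.X - PowerSeries.C (φ PowerSeries.X)) →+ (Fin n → QpModZp p) :=
    { toFun := fun a j ↦ (a : Fin n → BigRepModule ℤ_[p] p (QpModZp p)) j 0
      map_zero' := rfl
      map_add' := fun _ _ ↦ rfl }
  have hev : ∀ a j, ev a j = (a : Fin n → BigRepModule ℤ_[p] p (QpModZp p)) j 0 := fun _ _ ↦ rfl
  have hev_inj : Function.Injective ev := by
    intro a b hab
    exact Subtype.ext (eq_of_torsionBy_of_apply_zero_eq (hfib a) (hfib b) fun j ↦ by rw [← hev, ← hev, hab])
  have hev_surj : Function.Surjective ev := by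
    intro v
    obtain ⟨Ψ, hΨ, hΨ0⟩ := exists_of_torsionBy (𝒪 := ℤ_[p]) (n := n) hc (QpModZp.exists_pow_nsmul_eq_zero (p := p)) v
    exact ⟨⟨Ψ, (Submodule.mem_torsionBy_iff _ _).mpr hΨ⟩, funext fun j ↦ hΨ0 j⟩
  refine ⟨e.comp ev, fun c a ↦ ?_, fun σ a ↦ ?_, ?_, ?_⟩
  · -- semilinearity over `C`
    rw [AddMonoidHom.comp_apply, AddMonoidHom.comp_apply, ← he_lin]
    congr 1
    funext j
    rw [hev, Pi.smul_apply, hev, Submodule.coe_smul, Pi.smul_apply, BigRepModule.C_smul, BigRepModule.smul_apply]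
  · -- equivariance: the framed action on the fibre is the specialised matrix action
    rw [AddMonoidHom.comp_apply, AddMonoidHom.comp_apply, ← he_eq]
    congr 1
    funext i
    rw [hev, BigGaloisRep.torsionRep_apply_coe, matrixAction_apply_apply_of_torsionBy φ hφ ρ ρ₂ hρ₂ (hfib a)]
    rfl
  · -- finite kernel: `ev` is injective and maps `ker (e ∘ ev)` into `ker e`
    refine Finite.of_injective (fun a : (e.comp ev).ker ↦ (⟨ev a, ?_⟩ : e.ker)) fun a b hab ↦ ?_
    · have := a.2
      rwa [AddMonoidHom.mem_ker, AddMonoidHom.comp_apply] at this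
    · exact Subtype.ext (hev_inj (congrArg Subtype.val hab))
  · -- finite cokernel: `ev` is onto, so `range (e ∘ ev) = range e`
    have hrange : (e.comp ev).range = e.range := by
      refine le_antisymm (fun m ⟨a, ha⟩ ↦ ⟨ev a, ha⟩) fun m ⟨v, hv⟩ ↦ ?_
      obtain ⟨a, rfl⟩ := hev_surj v
      exact ⟨a, hv⟩
    rw [hrange]
    exact hcoker

/-! ## §2 The bridge: N1's conclusion from framed lattice data -/

set_option maxHeartbeats 1600000 in
/-- **Leaf N1 `stub_branchLattice` from its lattice-level core N1♭ (by name, prefix-agnostic).** For the road objects (`W, p, N, K, κ,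
𝔭bar, x, D`, `‖x k‖ < 1`) and FRAMED LATTICE DATA — a topology on `Λ = ℤ_p⟦X⟧` (topological ring, `(C p^k, X^m)` open), a continuous
`ρ : Γ_K →ₜ* GL (Fin 2) Λ`, (unr♭) a finite `S₀` off which `ρ` is unramified (`w ∈ S₀, p ∉ w ⇒ N ∈ w`), (fd₀♭) a `ℤ_p`-linear `e₀ : (ℚ_p/ℤ_p)² → E[p^∞]`
intertwining `ρ mod X` (entries through `constantCoeff`) with `(W.baseChange K).primaryTorsionGaloisRep p`, finite kernel and cokernel, and for
every `k` (rat_k) with (fd_k♭) a `ℤ_p`-point `φ`, `φ X = x k`, and `e : (ℚ_p/ℤ_p)² → A_{g_k}†` semilinear over `algebraMap ℤ_p 𝒪_k` intertwining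
`ρ mod (X − x_k)` with `(D k).Δ.selfDualCofreeRepOver K`, finite kernel and cokernel — THE CONCLUSION OF N1 HOLDS (v13c l.440–473 token for
token), witness `A₂ := Fin 2 → BigRepModule ℤ_[p] p (QpModZp p)` with the cofree realisation `ρ₂` of `ρ`.
[cite: Hida1986, Thm. 2.1 (2.2b) (2.2c)] [cite: Wiles1988, §2] [cite: Greenberg2006, p. 342 L4–11] -/
theorem branchLattice_conclusion_of_framed
    (W : WeierstrassCurve ℚ) [W.IsElliptic] [W.IsGloballyMinimal] (p : ℕ) [Fact p.Prime]
    (N : ℕ) (K : Type) [Field K] [NumberField K] (κ : ZpExtension K p) (𝔭bar : HeightOneSpectrum (𝓞 K))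
    (x : ℕ → ℤ_[p]) (D : ℕ → Skinner2016.HidaCongruentForm W p 1) (hx : ∀ k, ‖x k‖ < 1)
    (τΛ : TopologicalSpace (PowerSeries ℤ_[p])) (hR : IsTopologicalRing (PowerSeries ℤ_[p]))
    (hΛ : ∀ k m : ℕ, IsOpen ((Ideal.span {PowerSeries.C ((p : ℤ_[p]) ^ k), (PowerSeries.X : PowerSeries ℤ_[p]) ^ m} :
      Ideal (PowerSeries ℤ_[p])) : Set (PowerSeries ℤ_[p])))
    (ρ : FramedGaloisRep K (PowerSeries ℤ_[p]) 2)
    (hunr : ∃ S₀ : Set (HeightOneSpectrum (𝓞 K)), S₀.Finite ∧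
      (∀ v ∉ S₀, ∀ 𝔓 ∈ v.primesAbove, ∀ σ ∈ 𝔓.inertia (Field.absoluteGaloisGroup K), ρ σ = 1) ∧
      ∀ w ∈ S₀, ((p : ℕ) : 𝓞 K) ∉ w.asIdeal → ((N : ℕ) : 𝓞 K) ∈ w.asIdeal)
    (hfd₀ : ∃ e₀ : (Fin 2 → QpModZp p) →+ PrimaryTorsion (W.baseChange K).geomPoints p,
      (∀ (c : ℤ_[p]) (v : Fin 2 → QpModZp p), e₀ (c • v) = c • e₀ v) ∧
      (∀ (σ : Field.absoluteGaloisGroup K) (v : Fin 2 → QpModZp p),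
        e₀ (fun i ↦ ∑ j, PowerSeries.constantCoeff
          (((ρ σ : GL (Fin 2) (PowerSeries ℤ_[p])) : Matrix (Fin 2) (Fin 2) (PowerSeries ℤ_[p])) i j) • v j) =
          (W.baseChange K).primaryTorsionGaloisRep p σ (e₀ v)) ∧
      Finite e₀.ker ∧ Finite (PrimaryTorsion (W.baseChange K).geomPoints p ⧸ e₀.range))
    (hfd : ∀ k : ℕ, Function.Surjective (algebraMap ℤ_[p] (padicCoeffIntegers (D k).ι)) ∧
      ∃ (φ : PowerSeries ℤ_[p] →+* ℤ_[p]), (∀ r : ℤ_[p], φ (PowerSeries.C r) = r) ∧ φ PowerSeries.X = x k ∧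
      ∃ e : (Fin 2 → QpModZp p) →+ Cofree (D k).Δ.selfDualRep (padicCoeffField (D k).ι),
        (∀ (c : ℤ_[p]) (v : Fin 2 → QpModZp p), e (c • v) = algebraMap ℤ_[p] (padicCoeffIntegers (D k).ι) c • e v) ∧
        (∀ (σ : Field.absoluteGaloisGroup K) (v : Fin 2 → QpModZp p),
          e (fun i ↦ ∑ j, φ (((ρ σ : GL (Fin 2) (PowerSeries ℤ_[p])) : Matrix (Fin 2) (Fin 2) (PowerSeries ℤ_[p])) i j) • v j) =
            (D k).Δ.selfDualCofreeRepOver K σ (e v)) ∧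
        Finite e.ker ∧ Finite (Cofree (D k).Δ.selfDualRep (padicCoeffField (D k).ι) ⧸ e.range)) :
    ∃ (_ : TopologicalSpace (PowerSeries ℤ_[p])) (A₂ : Type) (_ : AddCommGroup A₂)
        (_ : Module (PowerSeries ℤ_[p]) A₂) (_ : TopologicalSpace A₂) (_ : DiscreteTopology A₂)
        (ρ₂ : ContinuousRep (Field.absoluteGaloisGroup K) (PowerSeries ℤ_[p]) A₂)
        (_ : TopologicalSpace (PowerSeries (PowerSeries ℤ_[p]))) (_ : IsTopologicalRing (PowerSeries (PowerSeries ℤ_[p])))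
        (_ : ContinuousSMul (PowerSeries (PowerSeries ℤ_[p])) (BigRepModule (PowerSeries ℤ_[p]) p A₂))
        (_ : Module (PowerSeries ℤ_[p]) (XBig κ ρ₂ 𝔭bar (∅ : Set (HeightOneSpectrum (𝓞 K)))))
        (_ : IsScalarTower (PowerSeries ℤ_[p]) (PowerSeries (PowerSeries ℤ_[p]))
          (XBig κ ρ₂ 𝔭bar (∅ : Set (HeightOneSpectrum (𝓞 K))))),
        (Literature.NumberTheory.IwasawaTheory.Greenberg2016.IsCofree (PowerSeries ℤ_[p]) A₂ ∧
          (∀ a : A₂, ∃ n : ℕ, (PowerSeries.X : PowerSeries ℤ_[p]) ^ n • a = 0) ∧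
          (∀ a : A₂, ∃ b : A₂, (PowerSeries.X : PowerSeries ℤ_[p]) • b = a) ∧
          (∀ (k : ℕ) (a : A₂), ∃ b : A₂, (PowerSeries.X - PowerSeries.C (x k)) • b = a) ∧
          (∃ S₀ : Set (HeightOneSpectrum (𝓞 K)), S₀.Finite ∧ GaloisRep.IsUnramifiedOutside S₀ ρ₂ ∧
            ∀ w ∈ S₀, ((p : ℕ) : 𝓞 K) ∉ w.asIdeal → ((N : ℕ) : 𝓞 K) ∈ w.asIdeal) ∧
          (∃ θ₀ : Submodule.torsionBy (PowerSeries ℤ_[p]) A₂ (PowerSeries.X : PowerSeries ℤ_[p]) →+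
              PrimaryTorsion (W.baseChange K).geomPoints p,
            (∀ (c : ℤ_[p]) (a : Submodule.torsionBy (PowerSeries ℤ_[p]) A₂ (PowerSeries.X : PowerSeries ℤ_[p])),
                θ₀ (PowerSeries.C c • a) = c • θ₀ a) ∧
            (∀ (σ : Field.absoluteGaloisGroup K)
                (a : Submodule.torsionBy (PowerSeries ℤ_[p]) A₂ (PowerSeries.X : PowerSeries ℤ_[p])),
                θ₀ (BigGaloisRep.torsionRep ρ₂ (PowerSeries.X : PowerSeries ℤ_[p]) σ a) =
                  (W.baseChange K).primaryTorsionGaloisRep p σ (θ₀ a)) ∧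
            Finite θ₀.ker ∧ Finite (PrimaryTorsion (W.baseChange K).geomPoints p ⧸ θ₀.range)) ∧
          (∀ k : ℕ, Function.Surjective (algebraMap ℤ_[p] (padicCoeffIntegers (D k).ι)) ∧
            ∃ θ : Submodule.torsionBy (PowerSeries ℤ_[p]) A₂ (PowerSeries.X - PowerSeries.C (x k)) →+
                Cofree (D k).Δ.selfDualRep (padicCoeffField (D k).ι),
              (∀ (c : ℤ_[p])
                  (a : Submodule.torsionBy (PowerSeries ℤ_[p]) A₂ (PowerSeries.X - PowerSeries.C (x k))),
                  θ (PowerSeries.C c • a) = algebraMap ℤ_[p] (padicCoeffIntegers (D k).ι) c • θ a) ∧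
              (∀ (σ : Field.absoluteGaloisGroup K)
                  (a : Submodule.torsionBy (PowerSeries ℤ_[p]) A₂ (PowerSeries.X - PowerSeries.C (x k))),
                  θ (BigGaloisRep.torsionRep ρ₂ (PowerSeries.X - PowerSeries.C (x k)) σ a) =
                    (D k).Δ.selfDualCofreeRepOver K σ (θ a)) ∧
              Finite θ.ker ∧ Finite (Cofree (D k).Δ.selfDualRep (padicCoeffField (D k).ι) ⧸ θ.range))) := by
  -- the cofree realisation of `ρ` (#1)
  obtain ⟨ρ₂, hρ₂, hker⟩ := exists_cofreeRealisation (n := 2) hΛ ρ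
  -- the free instances of the witness: DISCRETE topology on `B = ℤ_p⟦X⟧⟦T⟧`
  letI τB : TopologicalSpace (PowerSeries (PowerSeries ℤ_[p])) := ⊥
  haveI : DiscreteTopology (PowerSeries (PowerSeries ℤ_[p])) := ⟨rfl⟩
  haveI hB : IsTopologicalRing (PowerSeries (PowerSeries ℤ_[p])) :=
    { continuous_add := continuous_of_discreteTopology
      continuous_mul := continuous_of_discreteTopology
      continuous_neg := continuous_of_discreteTopology }
  -- the `Λ`-module structure on `X₂` through `Λ → B`
  letI mX : Module (PowerSeries ℤ_[p]) (XBig κ ρ₂ 𝔭bar (∅ : Set (HeightOneSpectrum (𝓞 K)))) :=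
    Module.compHom _ (algebraMap (PowerSeries ℤ_[p]) (PowerSeries (PowerSeries ℤ_[p])))
  have hST : IsScalarTower (PowerSeries ℤ_[p]) (PowerSeries (PowerSeries ℤ_[p]))
      (XBig κ ρ₂ 𝔭bar (∅ : Set (HeightOneSpectrum (𝓞 K)))) :=
    IsScalarTower.of_algebraMap_smul fun _ _ ↦ rfl
  refine ⟨τΛ, Fin 2 → BigRepModule ℤ_[p] p (QpModZp p), inferInstance, inferInstance, inferInstance, inferInstance, ρ₂, τB, hB,
    inferInstance, mX, hST, isCofree_pi, exists_X_pow_smul_eq_zero_pi, exists_X_smul_eq, fun k a ↦ exists_X_sub_C_smul_eq (x k) a,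
    ?_, ?_, fun k ↦ ⟨(hfd k).1, ?_⟩⟩
  · -- (unr)
    obtain ⟨S₀, hS₀f, hS₀u, hS₀N⟩ := hunr
    exact ⟨S₀, hS₀f, isUnramifiedOutside_of_framed ρ ρ₂ hker hS₀u, hS₀N⟩
  · -- (fd₀): the fibre at the point `constantCoeff` (`c = 0`)
    obtain ⟨e₀, he₀_lin, he₀_eq, he₀_ker, he₀_coker⟩ := hfd₀
    exact exists_fibreMap ρ ρ₂ hρ₂ PowerSeries.constantCoeff (fun r ↦ PowerSeries.constantCoeff_C r)
      (by rw [PowerSeries.constantCoeff_X]; exact dvd_zero _) X_sub_C_constantCoeff_X.symm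
      (fun c m ↦ c • m) (fun σ m ↦ (W.baseChange K).primaryTorsionGaloisRep p σ m) e₀ he₀_lin he₀_eq he₀_ker he₀_coker
  · -- (fd_k): the fibre at the point `φ`, `φ X = x_k`
    obtain ⟨φ, hφC, hφX, e, he_lin, he_eq, he_ker, he_coker⟩ := (hfd k).2
    exact exists_fibreMap ρ ρ₂ hρ₂ φ hφC (by rw [hφX]; exact dvd_of_norm_lt_one (hx k)) (by rw [hφX])
      (fun c m ↦ algebraMap ℤ_[p] (padicCoeffIntegers (D k).ι) c • m) (fun σ m ↦ (D k).Δ.selfDualCofreeRepOver K σ m)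
      e he_lin he_eq he_ker he_coker

/-! ## §3 The glue on the registered text: N1 (v13c `stub_branchLattice`, token for token) from the lattice-level leaf N1♭ -/

set_option maxHeartbeats 1600000 in
/-- **N1 from N1♭, ON THE REGISTERED TEXT.** The hypothesis is the lattice-level leaf «N1♭» = the v13c road prefix of `stub_branchLattice`
(l.400–439, token for token) followed by the FRAMED LATTICE DATA (a topology on `ℤ_p⟦X⟧` with `(C p^k, X^m)` open, a continuous
`ρ : Γ_K →ₜ* GL₂(ℤ_p⟦X⟧)` unramified off a finite `S₀` with `w ∈ S₀, w ∤ p ⇒ w ∣ N`, an isogeny `(ℚ_p/ℤ_p)² → E[p^∞]|Γ_K` intertwining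
`ρ mod X`, and for every `k` (rat_k) and an isogeny `(ℚ_p/ℤ_p)² → A_{g_k}†|Γ_K` intertwining `ρ mod (X − x_k)` through a `ℤ_p`-point `φ`,
`φ X = x_k`); the conclusion is the v13c `stub_branchLattice` text (l.400–473) TOKEN FOR TOKEN. Proof = `branchLattice_conclusion_of_framed`
with `‖x k‖ < 1` read off the package. A LEAD who registers N1♭ (`stub_branchLatticeFramed := <the hypothesis>`) closes the N1 slot by
`branchLattice_of_framed stub_branchLatticeFramed`. [cite: Hida1986, Thm. 2.1 (2.2b) (2.2c)] [cite: Wiles1988, §2] -/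
theorem branchLattice_of_framed
    (h :
        ∀ (W : WeierstrassCurve ℚ) [W.IsElliptic] [W.IsGloballyMinimal] (p : ℕ) [Fact p.Prime],
    ∀ (N : ℕ) [NeZero N] (K : Type) [Field K] [NumberField K] (Dt : ModularParametrizationData W N)
      (H : HeegnerDatum N (NumberField.discr K)) (ιK : K →+* ℂ) (P : (W.baseChange K).toAffine.Point),
      CellC W p → W.conductorNorm ℤ = N →
      IsImaginaryQuadratic K → NumberField.discr K < -4 → SatisfiesHeegnerHypothesis N K →
      (W.quadraticTwist (NumberField.discr K : ℚ)).entireLFunction 1 ≠ 0 →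
      WeierstrassCurve.Affine.Point.map ιK.toRatAlgHom P = heegnerPointComplex Dt H →
      ¬ (p : ℤ) ∣ Dt.c → ¬ IsOfFinAddOrder P →
      Odd (NumberField.discr K) →
      ∀ (κ : ZpExtension K p), κ.IsAnticyclotomic →
        ∀ (γ : Field.absoluteGaloisGroup K) [Fact (κ.IsTopGenerator γ)]
          (𝔭 : HeightOneSpectrum (𝓞 K)), ((p : ℕ) : 𝓞 K) ∈ 𝔭.asIdeal →
          𝔭.asIdeal.ramificationIdx (𝓞 ℚ) = 1 → 𝔭.asIdeal.inertiaDeg (𝓞 ℚ) = 1 →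
          ∀ (𝔭bar : HeightOneSpectrum (𝓞 K)), ((p : ℕ) : 𝓞 K) ∈ 𝔭bar.asIdeal → 𝔭bar ≠ 𝔭 →
            ((Ideal.span {(p : ℤ)}).primesOver (𝓞 K)).ncard = 2 →
          ∀ (f : CuspForm (CongruenceSubgroup.Gamma0 N) 2), IsNewformOf W f →
            ∀ (ι' : PadicAlgCl p ≃+* ℂ),
              (∀ (w : InfinitePlace K) (k : 𝓞 K),
                k ∈ 𝔭.asIdeal ↔ ‖ι'.symm (w.embedding (k : K))‖ < 1) →
              ∀ (ΩK : ℂ) (Ωp : ℂ_[p]) (Q : PowerSeries 𝓞_ℂ_[p]), ΩK ≠ 0 → ‖Ωp‖ = 1 →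
                R1.IsBDPLFunctionInt p ι' 𝔭 κ γ f ΩK Ωp Q →
      ∀ (L : PowerSeries (PowerSeries (unrIntegers p))) (x : ℕ → ℤ_[p]) (D : ℕ → Skinner2016.HidaCongruentForm W p 1),
        (∀ k, ‖x k‖ < 1) ∧ Filter.Tendsto x Filter.atTop (nhds 0) ∧
        (∃ e : ℕ, PowerSeries.C ((p : 𝓞_ℂ_[p]) ^ e) * Q ∈
          Ideal.span {PowerSeries.map (R1.unrToCpInt p) (PowerSeries.map (PowerSeries.constantCoeff (R := unrIntegers p)) L)}) ∧
        (∀ k : ℕ, (∀ y : coeffField (D k).g, ι' ((D k).ι y) = (y : ℂ)) ∧ 2 * ((p : ℤ) - 1) ∣ (D k).k - 2 ∧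
          ∃ (ΩKg : ℂ) (Ωpg : ℂ_[p]) (Lg : UnrSeries p), ΩKg ≠ 0 ∧ ‖Ωpg‖ = 1 ∧
            IsBDPLFunctionWt ι' 𝔭 κ γ (D k).g ΩKg Ωpg Lg ∧
          ∃ Ψ : UnrSeries p,
            (∃ U : PowerSeries (PowerSeries (unrIntegers p)),
              PowerSeries.map (PowerSeries.C (R := unrIntegers p)) Ψ =
                L + PowerSeries.C (PowerSeries.X - PowerSeries.C (toUnr p (x k))) * U) ∧
            (∃ e : ℕ, PowerSeries.C ((p : 𝓞_ℂ_[p]) ^ e) * PowerSeries.map (R1.unrToCpInt p) Ψ ∈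
              Ideal.span {PowerSeries.map (R1.unrToCpInt p) Lg})) ∧
        (∃ A : ℕ → UnrSeries p, ∀ ℓ : ℕ, ℓ.Prime → ¬ ℓ ∣ N →
          (∃ U : UnrSeries p, A ℓ = PowerSeries.C (toUnr p ((W.frobeniusTrace ℓ : ℤ) : ℤ_[p])) + PowerSeries.X * U) ∧
          ∀ k : ℕ, ∃ (c : unrIntegers p) (U : UnrSeries p),
            A ℓ = PowerSeries.C c + (PowerSeries.X - PowerSeries.C (toUnr p (x k))) * U ∧
            ((c : ℂ_[p]) = algebraMap (PadicAlgCl p) ℂ_[p]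
              ((D k).ι ⟨(UpperHalfPlane.qExpansion 1 ⇑(D k).g).coeff ℓ, coeff_mem_coeffField (D k).g ℓ⟩))) →
      ∃ (_ : TopologicalSpace (PowerSeries ℤ_[p])) (_ : IsTopologicalRing (PowerSeries ℤ_[p]))
        (_ : ∀ k m : ℕ, IsOpen ((Ideal.span {PowerSeries.C ((p : ℤ_[p]) ^ k), (PowerSeries.X : PowerSeries ℤ_[p]) ^ m} :
          Ideal (PowerSeries ℤ_[p])) : Set (PowerSeries ℤ_[p])))
        (ρ : FramedGaloisRep K (PowerSeries ℤ_[p]) 2),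
        (∃ S₀ : Set (HeightOneSpectrum (𝓞 K)), S₀.Finite ∧
          (∀ v ∉ S₀, ∀ 𝔓 ∈ v.primesAbove, ∀ σ ∈ 𝔓.inertia (Field.absoluteGaloisGroup K), ρ σ = 1) ∧
          ∀ w ∈ S₀, ((p : ℕ) : 𝓞 K) ∉ w.asIdeal → ((N : ℕ) : 𝓞 K) ∈ w.asIdeal) ∧
        (∃ e₀ : (Fin 2 → QpModZp p) →+ PrimaryTorsion (W.baseChange K).geomPoints p,
          (∀ (c : ℤ_[p]) (v : Fin 2 → QpModZp p), e₀ (c • v) = c • e₀ v) ∧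
          (∀ (σ : Field.absoluteGaloisGroup K) (v : Fin 2 → QpModZp p),
            e₀ (fun i ↦ ∑ j, PowerSeries.constantCoeff
              (((ρ σ : GL (Fin 2) (PowerSeries ℤ_[p])) : Matrix (Fin 2) (Fin 2) (PowerSeries ℤ_[p])) i j) • v j) =
              (W.baseChange K).primaryTorsionGaloisRep p σ (e₀ v)) ∧
          Finite e₀.ker ∧ Finite (PrimaryTorsion (W.baseChange K).geomPoints p ⧸ e₀.range)) ∧
        (∀ k : ℕ, Function.Surjective (algebraMap ℤ_[p] (padicCoeffIntegers (D k).ι)) ∧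
          ∃ (φ : PowerSeries ℤ_[p] →+* ℤ_[p]), (∀ r : ℤ_[p], φ (PowerSeries.C r) = r) ∧ φ PowerSeries.X = x k ∧
          ∃ e : (Fin 2 → QpModZp p) →+ Cofree (D k).Δ.selfDualRep (padicCoeffField (D k).ι),
            (∀ (c : ℤ_[p]) (v : Fin 2 → QpModZp p), e (c • v) = algebraMap ℤ_[p] (padicCoeffIntegers (D k).ι) c • e v) ∧
            (∀ (σ : Field.absoluteGaloisGroup K) (v : Fin 2 → QpModZp p),
              e (fun i ↦ ∑ j, φ (((ρ σ : GL (Fin 2) (PowerSeries ℤ_[p])) : Matrix (Fin 2) (Fin 2) (PowerSeries ℤ_[p])) i j) •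
                v j) = (D k).Δ.selfDualCofreeRepOver K σ (e v)) ∧
            Finite e.ker ∧ Finite (Cofree (D k).Δ.selfDualRep (padicCoeffField (D k).ι) ⧸ e.range))) :
        ∀ (W : WeierstrassCurve ℚ) [W.IsElliptic] [W.IsGloballyMinimal] (p : ℕ) [Fact p.Prime],
    ∀ (N : ℕ) [NeZero N] (K : Type) [Field K] [NumberField K] (Dt : ModularParametrizationData W N)
      (H : HeegnerDatum N (NumberField.discr K)) (ιK : K →+* ℂ) (P : (W.baseChange K).toAffine.Point),
      CellC W p → W.conductorNorm ℤ = N →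
      IsImaginaryQuadratic K → NumberField.discr K < -4 → SatisfiesHeegnerHypothesis N K →
      (W.quadraticTwist (NumberField.discr K : ℚ)).entireLFunction 1 ≠ 0 →
      WeierstrassCurve.Affine.Point.map ιK.toRatAlgHom P = heegnerPointComplex Dt H →
      ¬ (p : ℤ) ∣ Dt.c → ¬ IsOfFinAddOrder P →
      Odd (NumberField.discr K) →
      ∀ (κ : ZpExtension K p), κ.IsAnticyclotomic →
        ∀ (γ : Field.absoluteGaloisGroup K) [Fact (κ.IsTopGenerator γ)]
          (𝔭 : HeightOneSpectrum (𝓞 K)), ((p : ℕ) : 𝓞 K) ∈ 𝔭.asIdeal →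
          𝔭.asIdeal.ramificationIdx (𝓞 ℚ) = 1 → 𝔭.asIdeal.inertiaDeg (𝓞 ℚ) = 1 →
          ∀ (𝔭bar : HeightOneSpectrum (𝓞 K)), ((p : ℕ) : 𝓞 K) ∈ 𝔭bar.asIdeal → 𝔭bar ≠ 𝔭 →
            ((Ideal.span {(p : ℤ)}).primesOver (𝓞 K)).ncard = 2 →
          ∀ (f : CuspForm (CongruenceSubgroup.Gamma0 N) 2), IsNewformOf W f →
            ∀ (ι' : PadicAlgCl p ≃+* ℂ),
              (∀ (w : InfinitePlace K) (k : 𝓞 K),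
                k ∈ 𝔭.asIdeal ↔ ‖ι'.symm (w.embedding (k : K))‖ < 1) →
              ∀ (ΩK : ℂ) (Ωp : ℂ_[p]) (Q : PowerSeries 𝓞_ℂ_[p]), ΩK ≠ 0 → ‖Ωp‖ = 1 →
                R1.IsBDPLFunctionInt p ι' 𝔭 κ γ f ΩK Ωp Q →
      ∀ (L : PowerSeries (PowerSeries (unrIntegers p))) (x : ℕ → ℤ_[p]) (D : ℕ → Skinner2016.HidaCongruentForm W p 1),
        (∀ k, ‖x k‖ < 1) ∧ Filter.Tendsto x Filter.atTop (nhds 0) ∧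
        (∃ e : ℕ, PowerSeries.C ((p : 𝓞_ℂ_[p]) ^ e) * Q ∈
          Ideal.span {PowerSeries.map (R1.unrToCpInt p) (PowerSeries.map (PowerSeries.constantCoeff (R := unrIntegers p)) L)}) ∧
        (∀ k : ℕ, (∀ y : coeffField (D k).g, ι' ((D k).ι y) = (y : ℂ)) ∧ 2 * ((p : ℤ) - 1) ∣ (D k).k - 2 ∧
          ∃ (ΩKg : ℂ) (Ωpg : ℂ_[p]) (Lg : UnrSeries p), ΩKg ≠ 0 ∧ ‖Ωpg‖ = 1 ∧
            IsBDPLFunctionWt ι' 𝔭 κ γ (D k).g ΩKg Ωpg Lg ∧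
          ∃ Ψ : UnrSeries p,
            (∃ U : PowerSeries (PowerSeries (unrIntegers p)),
              PowerSeries.map (PowerSeries.C (R := unrIntegers p)) Ψ =
                L + PowerSeries.C (PowerSeries.X - PowerSeries.C (toUnr p (x k))) * U) ∧
            (∃ e : ℕ, PowerSeries.C ((p : 𝓞_ℂ_[p]) ^ e) * PowerSeries.map (R1.unrToCpInt p) Ψ ∈
              Ideal.span {PowerSeries.map (R1.unrToCpInt p) Lg})) ∧
        (∃ A : ℕ → UnrSeries p, ∀ ℓ : ℕ, ℓ.Prime → ¬ ℓ ∣ N →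
          (∃ U : UnrSeries p, A ℓ = PowerSeries.C (toUnr p ((W.frobeniusTrace ℓ : ℤ) : ℤ_[p])) + PowerSeries.X * U) ∧
          ∀ k : ℕ, ∃ (c : unrIntegers p) (U : UnrSeries p),
            A ℓ = PowerSeries.C c + (PowerSeries.X - PowerSeries.C (toUnr p (x k))) * U ∧
            ((c : ℂ_[p]) = algebraMap (PadicAlgCl p) ℂ_[p]
              ((D k).ι ⟨(UpperHalfPlane.qExpansion 1 ⇑(D k).g).coeff ℓ, coeff_mem_coeffField (D k).g ℓ⟩))) →
      ∃ (_ : TopologicalSpace (PowerSeries ℤ_[p])) (A₂ : Type) (_ : AddCommGroup A₂)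
        (_ : Module (PowerSeries ℤ_[p]) A₂) (_ : TopologicalSpace A₂) (_ : DiscreteTopology A₂)
        (ρ₂ : ContinuousRep (Field.absoluteGaloisGroup K) (PowerSeries ℤ_[p]) A₂)
        (_ : TopologicalSpace (PowerSeries (PowerSeries ℤ_[p]))) (_ : IsTopologicalRing (PowerSeries (PowerSeries ℤ_[p])))
        (_ : ContinuousSMul (PowerSeries (PowerSeries ℤ_[p])) (BigRepModule (PowerSeries ℤ_[p]) p A₂))
        (_ : Module (PowerSeries ℤ_[p]) (XBig κ ρ₂ 𝔭bar (∅ : Set (HeightOneSpectrum (𝓞 K)))))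
        (_ : IsScalarTower (PowerSeries ℤ_[p]) (PowerSeries (PowerSeries ℤ_[p]))
          (XBig κ ρ₂ 𝔭bar (∅ : Set (HeightOneSpectrum (𝓞 K))))),
        (Literature.NumberTheory.IwasawaTheory.Greenberg2016.IsCofree (PowerSeries ℤ_[p]) A₂ ∧
          (∀ a : A₂, ∃ n : ℕ, (PowerSeries.X : PowerSeries ℤ_[p]) ^ n • a = 0) ∧
          (∀ a : A₂, ∃ b : A₂, (PowerSeries.X : PowerSeries ℤ_[p]) • b = a) ∧
          (∀ (k : ℕ) (a : A₂), ∃ b : A₂, (PowerSeries.X - PowerSeries.C (x k)) • b = a) ∧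
          (∃ S₀ : Set (HeightOneSpectrum (𝓞 K)), S₀.Finite ∧ GaloisRep.IsUnramifiedOutside S₀ ρ₂ ∧
            ∀ w ∈ S₀, ((p : ℕ) : 𝓞 K) ∉ w.asIdeal → ((N : ℕ) : 𝓞 K) ∈ w.asIdeal) ∧
          (∃ θ₀ : Submodule.torsionBy (PowerSeries ℤ_[p]) A₂ (PowerSeries.X : PowerSeries ℤ_[p]) →+
              PrimaryTorsion (W.baseChange K).geomPoints p,
            (∀ (c : ℤ_[p]) (a : Submodule.torsionBy (PowerSeries ℤ_[p]) A₂ (PowerSeries.X : PowerSeries ℤ_[p])),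
                θ₀ (PowerSeries.C c • a) = c • θ₀ a) ∧
            (∀ (σ : Field.absoluteGaloisGroup K)
                (a : Submodule.torsionBy (PowerSeries ℤ_[p]) A₂ (PowerSeries.X : PowerSeries ℤ_[p])),
                θ₀ (BigGaloisRep.torsionRep ρ₂ (PowerSeries.X : PowerSeries ℤ_[p]) σ a) =
                  (W.baseChange K).primaryTorsionGaloisRep p σ (θ₀ a)) ∧
            Finite θ₀.ker ∧ Finite (PrimaryTorsion (W.baseChange K).geomPoints p ⧸ θ₀.range)) ∧
          (∀ k : ℕ, Function.Surjective (algebraMap ℤ_[p] (padicCoeffIntegers (D k).ι)) ∧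
            ∃ θ : Submodule.torsionBy (PowerSeries ℤ_[p]) A₂ (PowerSeries.X - PowerSeries.C (x k)) →+
                Cofree (D k).Δ.selfDualRep (padicCoeffField (D k).ι),
              (∀ (c : ℤ_[p])
                  (a : Submodule.torsionBy (PowerSeries ℤ_[p]) A₂ (PowerSeries.X - PowerSeries.C (x k))),
                  θ (PowerSeries.C c • a) = algebraMap ℤ_[p] (padicCoeffIntegers (D k).ι) c • θ a) ∧
              (∀ (σ : Field.absoluteGaloisGroup K)
                  (a : Submodule.torsionBy (PowerSeries ℤ_[p]) A₂ (PowerSeries.X - PowerSeries.C (x k))),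
                  θ (BigGaloisRep.torsionRep ρ₂ (PowerSeries.X - PowerSeries.C (x k)) σ a) =
                    (D k).Δ.selfDualCofreeRepOver K σ (θ a)) ∧
              Finite θ.ker ∧ Finite (Cofree (D k).Δ.selfDualRep (padicCoeffField (D k).ι) ⧸ θ.range))) := by
  intro W _ _ p _ N _ K _ _ Dt H ιK P hC hN hK hdisc hH hL1 hP hc hPinf hodd κ hκ γ _ 𝔭 h𝔭 hram hdeg 𝔭bar h𝔭bar hne hsplit
    f hf ι' hι' ΩK Ωp Q hΩK hΩp hQ L x D hpkg
  obtain ⟨τΛ, hR, hΛ, ρ, hunr, hfd₀, hfd⟩ := h W p N K Dt H ιK P hC hN hK hdisc hH hL1 hP hc hPinf hodd κ hκ γ 𝔭 h𝔭 hram hdeg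
    𝔭bar h𝔭bar hne hsplit f hf ι' hι' ΩK Ωp Q hΩK hΩp hQ L x D hpkg
  exact branchLattice_conclusion_of_framed W p N K κ 𝔭bar x D hpkg.1 τΛ hR hΛ ρ hunr hfd₀ hfd

end Summit.BirchSwinnertonDyer.BirchSwinnertonDyer.Theorems.TelescopeBranchLatticeOfFramed
end
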